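import Summits.ValiantsHypothesis.ValiantsHypothesis.Theorems.DefinabilityGapZeroPattern
import HarnessLib

/-!
# DefinabilityGap — the ONE-COLUMN PIVOT CERTIFICATE for the planted Kabanets–Impagliazzo permanent design (unconditional)

Route `route-ValiantsHypothesis-DefinabilityGap` (decomp-valiant cycle 1, lens 5, gen 7), supporting the hitting item
`KIPlantedHitting` (stmt-ValiantsHypothesis-23547) through its size road R_K1.1 («every `2q(m)+1` block permanents
`P_c = per_m(y|S_c)` of the planted generator are algebraically independent, eventually in `m`»).

THE CERTIFICATE (purely combinatorial; all algebra is discharged by the zero-pattern rung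
`DefinabilityGapZeroPattern.kiPer_algebraicIndependent_of_zeroPattern`). Fix a grid column `s₀ : Fin m` and give every
coordinate `c ∈ T` a PIVOT ROW `r c : Fin m`. Put into the zero set `W` the GADGET cells `E_c(r c, s)`, `s ≠ s₀`, of every
`c ∈ T` (row `r c` of the block `S_c` is killed except at column `s₀`). If
 (i) the pivot cells `E_c(r c, s₀)` (`c ∈ T`) are pairwise distinct, and
 (ii) for every `c ∈ T` some transversal of `S_c` through the pivot position `(r c, s₀)` avoids `W`
   (the pivot minor of `c` minus the COLLATERAL zeros — gadget cells of other curves lying on `S_c` — has a transversal),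
then `(P_c)_{c ∈ T}` is algebraically independent over `ℂ` (`kiPer_algebraicIndependent_of_pivotCertificate`).
Point: under the gadget zeros a curve is live in column `s₀` ONLY in its own pivot row (`row_eq_of_liveAt`), so every other
curve is DEAD at each pivot and the triangular condition of the rung is vacuous — the certificate is ORDER-FREE (no peeling
order, no ranking to search). Lens-5 g7 instrument (`v7/instrument-zero.md`, `pivot.py`): every tested family with
`|T| ≤ 2q+1` is certified for `m ≥ 6` (random and structured: two/three translation classes, pencils, 2-point bundles,
conics), first random matching, failures at `m ≤ 5` are always (ii) (collateral density `≈ 2/m … 4/m` per row). The road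
to R_K1.1 is the finite Hall-type statement `KIPivotCertifiable m T` for `|T| ≤ 2q+1`, `m ≥ m₀`. 0 sorry.
-/

noncomputable section

open MvPolynomial
open Literature.Computability.AlgebraicComplexity Literature.Computability.MetaComplexity
open Summit.ValiantsHypothesis.ValiantsHypothesis.Theorems.DefinabilityGapAffineRung
open Summit.ValiantsHypothesis.ValiantsHypothesis.Theorems.DefinabilityGapZeroPattern

namespace Summit.ValiantsHypothesis.ValiantsHypothesis.Theorems.DefinabilityGapPivotCertificate

variable {m : ℕ}

/-! ## 1. Positions inside a block -/

/-- The abscissa of the cell at position `p` of any block is `permPad p` — independent of the curve. [this file] -/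
theorem cellEmb_fst (m : ℕ) (c : Fin 3 → Fin (qOf m)) (p : Fin m × Fin m) :
    (cellEmb m c p).1 = permPad (sq_le_qOf m) p := by
  show (quadDesign m c (permPad (sq_le_qOf m) p)).1 = _
  rw [quadDesign_fst]
where
  /-- local copy of `DefinabilityGapSymmetry.quadDesign_fst` (that file is not imported here). [this file] -/
  quadDesign_fst {m : ℕ} {c : Fin 3 → Fin (qOf m)} {k : Fin (qOf m)} : (quadDesign m c k).1 = k := by
    haveI : NeZero (qOf m) := ⟨(qOf_spec m).2.ne_zero⟩
    exact (ZMod.finEquiv (qOf m)).toEquiv.symm_apply_apply k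

/-- Two blocks meet only at equal positions: `E_c p = E_{c'} p' ⟹ p = p'`. [this file] -/
theorem pos_eq_of_cellEmb_eq (m : ℕ) {c c' : Fin 3 → Fin (qOf m)} {p p' : Fin m × Fin m}
    (h : cellEmb m c p = cellEmb m c' p') : p = p' := by
  have h1 := congrArg Prod.fst h
  rw [cellEmb_fst, cellEmb_fst] at h1
  exact (permPad (sq_le_qOf m)).injective h1

/-! ## 2. The certificate -/

/-- Position `p` of the block `S_c` is LIVE under the zero set `W`: some `W`-avoiding transversal passes through it.
[this file] -/
def LiveAt (m : ℕ) (W : Finset (Fin (qOf m) × Fin (qOf m))) (c : Fin 3 → Fin (qOf m)) (p : Fin m × Fin m) : Prop :=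
  ∃ ρ : Equiv.Perm (Fin m), (∀ i, cellEmb m c (ρ i, i) ∉ W) ∧ ρ p.2 = p.1

/-- The GADGET zeros of a pivot assignment: row `r c` of every `c ∈ T`, off the pivot column `s₀`. [this file] -/
def pivotZeros (m : ℕ) (T : Finset (Fin 3 → Fin (qOf m))) (s₀ : Fin m) (r : (Fin 3 → Fin (qOf m)) → Fin m) :
    Finset (Fin (qOf m) × Fin (qOf m)) :=
  T.biUnion fun c => (Finset.univ.filter fun s : Fin m => s ≠ s₀).image fun s => cellEmb m c (r c, s)

/-- A gadget cell lies in the zero set. [this file] -/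
theorem mem_pivotZeros {T : Finset (Fin 3 → Fin (qOf m))} {s₀ : Fin m} {r : (Fin 3 → Fin (qOf m)) → Fin m}
    {c : Fin 3 → Fin (qOf m)} (hc : c ∈ T) {s : Fin m} (hs : s ≠ s₀) :
    cellEmb m c (r c, s) ∈ pivotZeros m T s₀ r := by
  classical
  exact Finset.mem_biUnion.2 ⟨c, hc, Finset.mem_image.2 ⟨s, Finset.mem_filter.2 ⟨Finset.mem_univ _, hs⟩, rfl⟩⟩

/-- **The one-column pivot certificate** of `T` with pivot column `s₀` and pivot rows `r`:
(i) distinct pivot cells; (ii) every pivot position is live under the gadget zeros. [this file] -/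
def KIPivotCertificate (m : ℕ) (T : Finset (Fin 3 → Fin (qOf m))) (s₀ : Fin m)
    (r : (Fin 3 → Fin (qOf m)) → Fin m) : Prop :=
  (∀ c ∈ T, ∀ c' ∈ T, cellEmb m c (r c, s₀) = cellEmb m c' (r c', s₀) → c = c') ∧
  ∀ c ∈ T, LiveAt m (pivotZeros m T s₀ r) c (r c, s₀)

/-- `T` is PIVOT-CERTIFIABLE: some column and pivot rows certify it. [this file] -/
def KIPivotCertifiable (m : ℕ) (T : Finset (Fin 3 → Fin (qOf m))) : Prop :=
  ∃ (s₀ : Fin m) (r : (Fin 3 → Fin (qOf m)) → Fin m), KIPivotCertificate m T s₀ r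

/-- **Key combinatorial fact.** Under the gadget zeros, a curve `c ∈ T` is live at a position of the pivot column `s₀` only
in its own pivot row. [this file] -/
theorem row_eq_of_liveAt {T : Finset (Fin 3 → Fin (qOf m))} {s₀ : Fin m} {r : (Fin 3 → Fin (qOf m)) → Fin m}
    {c : Fin 3 → Fin (qOf m)} (hc : c ∈ T) {p : Fin m × Fin m} (hp : p.2 = s₀)
    (hl : LiveAt m (pivotZeros m T s₀ r) c p) : p.1 = r c := by
  obtain ⟨ρ, havoid, hρ⟩ := hl
  by_contra hne
  set j := ρ.symm (r c) with hj
  have hρj : ρ j = r c := ρ.apply_symm_apply (r c)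
  have hjs : j ≠ s₀ := by
    intro h
    apply hne
    rw [← hρ, hp, ← h, hρj]
  exact havoid j (by rw [hρj]; exact mem_pivotZeros hc hjs)

/-! ## 3. Pivot certificate ⟹ algebraic independence -/

/-- A height putting a set `P` of cells above all others, injective. [this file] -/
def liftHeight (m : ℕ) (P : Finset (Fin (qOf m) × Fin (qOf m))) (x : Fin (qOf m) × Fin (qOf m)) : ℕ :=
  (if x ∈ P then qOf m * qOf m else 0) + ((x.1 : ℕ) * qOf m + (x.2 : ℕ))

/-- The row-major code `x.1 * q + x.2` of a seed cell is `< q²`. [this file] -/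
theorem enc_lt (x : Fin (qOf m) × Fin (qOf m)) : (x.1 : ℕ) * qOf m + (x.2 : ℕ) < qOf m * qOf m := by
  have h1 : (x.1 : ℕ) + 1 ≤ qOf m := x.1.isLt
  have h2 : (x.2 : ℕ) < qOf m := x.2.isLt
  calc (x.1 : ℕ) * qOf m + (x.2 : ℕ) < (x.1 : ℕ) * qOf m + qOf m := by omega
    _ = ((x.1 : ℕ) + 1) * qOf m := by ring
    _ ≤ qOf m * qOf m := Nat.mul_le_mul_right _ h1

/-- The row-major code of a seed cell is injective. [this file] -/
theorem enc_injective : Function.Injective fun x : Fin (qOf m) × Fin (qOf m) => (x.1 : ℕ) * qOf m + (x.2 : ℕ) := by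
  intro x y h
  have h2x : (x.2 : ℕ) < qOf m := x.2.isLt
  have h2y : (y.2 : ℕ) < qOf m := y.2.isLt
  have hx : ((x.1 : ℕ) * qOf m + (x.2 : ℕ)) / qOf m = x.1 := by
    rw [Nat.mul_comm, Nat.mul_add_div (by omega), Nat.div_eq_of_lt h2x, add_zero]
  have hy : ((y.1 : ℕ) * qOf m + (y.2 : ℕ)) / qOf m = y.1 := by
    rw [Nat.mul_comm, Nat.mul_add_div (by omega), Nat.div_eq_of_lt h2y, add_zero]
  have h' : (x.1 : ℕ) * qOf m + (x.2 : ℕ) = (y.1 : ℕ) * qOf m + (y.2 : ℕ) := h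
  have h1 : (x.1 : ℕ) = y.1 := by rw [← hx, ← hy, h']
  have h2 : (x.2 : ℕ) = y.2 := by rw [h1] at h'; omega
  exact Prod.ext (Fin.ext h1) (Fin.ext h2)

/-- `liftHeight P` is injective. [this file] -/
theorem liftHeight_injective (P : Finset (Fin (qOf m) × Fin (qOf m))) : Function.Injective (liftHeight m P) := by
  intro x y h
  unfold liftHeight at h
  have hx := enc_lt x
  have hy := enc_lt y
  by_cases hxP : x ∈ P <;> by_cases hyP : y ∈ P <;> simp only [hxP, hyP, if_true, if_false] at h
  · exact enc_injective (by dsimp only; omega)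
  · omega
  · omega
  · exact enc_injective (by dsimp only; omega)

/-- Cells of `P` are higher than cells outside `P`. [this file] -/
theorem liftHeight_lt_of_mem {P : Finset (Fin (qOf m) × Fin (qOf m))} {x y : Fin (qOf m) × Fin (qOf m)}
    (hx : x ∉ P) (hy : y ∈ P) : liftHeight m P x < liftHeight m P y := by
  unfold liftHeight
  rw [if_neg hx, if_pos hy]
  have := enc_lt x
  omega

/-- **PIVOT RUNG (unconditional, order-free, kernel).** A one-column pivot certificate makes the block permanents
`(per_m(y|S_c))_{c ∈ T}` of the planted generator algebraically independent over `ℂ`. [this file] -/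
theorem kiPer_algebraicIndependent_of_pivotCertificate (m : ℕ) (T : Finset (Fin 3 → Fin (qOf m))) (s₀ : Fin m)
    (r : (Fin 3 → Fin (qOf m)) → Fin m) (h : KIPivotCertificate m T s₀ r) :
    AlgebraicIndependent ℂ (fun c : T => kiPer m (c : Fin 3 → Fin (qOf m))) := by
  classical
  obtain ⟨hinj, hlive⟩ := h
  set W := pivotZeros m T s₀ r with hW
  set P : Finset (Fin (qOf m) × Fin (qOf m)) := T.image fun c => cellEmb m c (r c, s₀) with hP
  -- no curve of `T` other than `c` is live at the pivot of `c`; `c` itself is live in column `s₀` only at its pivot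
  have key : ∀ c ∈ T, ∀ c' ∈ T, ∀ p : Fin m × Fin m, cellEmb m c' p = cellEmb m c (r c, s₀) →
      LiveAt m W c' p → c' = c ∧ p = (r c, s₀) := by
    intro c hc c' hc' p hp hl
    have hpp : p = (r c, s₀) := pos_eq_of_cellEmb_eq m hp
    have h1 : p.1 = r c' := row_eq_of_liveAt hc' (by rw [hpp]) hl
    rw [hpp] at h1
    have h2 : cellEmb m c' (r c', s₀) = cellEmb m c (r c, s₀) := by rw [← hp, hpp, ← h1]
    exact ⟨(hinj c hc c' hc' h2.symm).symm, hpp⟩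
  refine kiPer_algebraicIndependent_of_zeroPattern m T W (liftHeight m P) (liftHeight_injective P)
    (fun c => (r c, s₀)) (fun c hc => hlive c hc) ?_ ?_
  · -- (top): a live non-pivot position of `c` is not a pivot cell of anybody, hence lower than every pivot cell
    intro c hc p hp hl
    have hnot : cellEmb m c p ∉ P := by
      intro hmem
      obtain ⟨c'', hc'', he⟩ := Finset.mem_image.1 hmem
      have hpp : p = (r c'', s₀) := (pos_eq_of_cellEmb_eq m he).symm
      have h1 : p.1 = r c := row_eq_of_liveAt hc (by rw [hpp]) hl
      apply hp
      rw [hpp] at h1 ⊢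
      exact Prod.ext h1 rfl
    exact liftHeight_lt_of_mem hnot (Finset.mem_image.2 ⟨c, hc, rfl⟩)
  · -- (tri): vacuous — another curve live at the pivot of `c` would be `c` itself
    intro c hc c' hc' hne p hp hl
    exact absurd (key c hc c' hc' p hp hl).1 hne

/-- Certifiable families are independent. [this file] -/
theorem kiPer_algebraicIndependent_of_pivotCertifiable (m : ℕ) (T : Finset (Fin 3 → Fin (qOf m)))
    (h : KIPivotCertifiable m T) : AlgebraicIndependent ℂ (fun c : T => kiPer m (c : Fin 3 → Fin (qOf m))) := by
  obtain ⟨s₀, r, h⟩ := h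
  exact kiPer_algebraicIndependent_of_pivotCertificate m T s₀ r h

end Summit.ValiantsHypothesis.ValiantsHypothesis.Theorems.DefinabilityGapPivotCertificate

end
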